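import Literature.Probability.RandomPlanarGeometry.SkorokhodEmbedding
import HarnessLib

/-!
# Skorokhod embedding of the simple random walk in Brownian motion: renewal structure

Topic `Literature/Probability/RandomPlanarGeometry`, sub-namespace `SkorokhodSRW` (the object:
the simple random walk embedded in the Brownian path by iterated exit times of unit
intervals). Everything here is PROVED; no named fact is introduced.

This is the first brick of Part B (random walk ↔ Brownian motion, up to constants) of the
printed proof of `LSW2001_srw_nonIntersection_five_eighths` (`PlaneNonIntersection.lean`):
Lawler, *Cut times for simple random walk*, EJP **1** (1996), paper 13, **§3 (Skorokhod
embedding)**, first display: "Let `X(t)` be a one-dimensional Brownian motion starting at the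
origin. Let `τ₀ = 0`, and for `n > 0`, `τ_n = inf{t > τ_{n-1} : |X(t) - X(τ_{n-1})| = 1}`,
`Y(n) = X(τ_n)`. This is the well known Skorokhod embedding of a simple random walk `Y(n)` in
a Brownian motion. It is easy to check that `E(τ₁) = 1` and `E(e^{tτ₁}) < ∞` for some `t > 0`."
(Lawler then derives Lemma 3.1, the strong approximation `sup_{t ≤ n} |B(t) - S(td)| ≤ n^{1/4+ε}`
off an event of probability `≤ a e^{-n^δ}`; that is the target of the sibling files.)

We realise the embedding on the **path space** `C([0, ∞), ℝ)` under the Wiener law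
`wienerLawC` (`BrownianExitPathLaw`), where the strong Markov property at the exit time of
`(-1, 1)` is available in the two forms `map_postExitPath_wienerLawC` (the post-exit path is
again Wiener distributed) and `indepFun_postExitPath_wienerLawC` (it is independent of the pair
(exit time, pre-exit path)); Durrett (2019), proof of Thm. 8.2.1, iterates exactly this. (The
general randomised embedding of finite martingales, `SkorokhodEmbedding.exists_embedding`, is
imported only for its path-space lemmas; for `±1` steps the embedding below is the explicit,
non-randomised one of Lawler's display, realised on the canonical space, which is what the
strong approximation needs: i.i.d. gaps with exponential tails and the walk as a FUNCTION of
the Brownian path.)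

* `next = postExitPath (-1) 1` (one renewal), `iter k = next^[k]` (the path after the `k`-th
  embedding time, re-centred), `gapNN k` / `gap k` (`Δτ_k = τ_{k+1} - τ_k`, in `ℝ≥0` / `ℝ`),
  `step k` (`ΔY_k = Y(k+1) - Y(k)`), `embTime n = τ_n`, `walk n = Y(n)`;
* **renewal structure**: `next` and all `iter k` preserve the Wiener law
  (`measurePreserving_next/iter`); `(Δτ₀, ΔY₀)` is independent of every functional of the
  renewed path (`indepFun_gapStep_zero_comp_next`); the recursion `gap (k+1) p = gap k (next p)`
  etc. is definitional;
* **a.s. structure**: every embedding time is finite and every step is `±1`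
  (`ae_exit_ne_top_and_step`); the **embedding identity** `p(τ_n) = Y(n)` for all `n`, a.s.
  (`ae_apply_embTime_eq_walk`);
* **laws**: `P[ΔY_k = 1] = P[ΔY_k = -1] = 1/2` and the **simple-random-walk law**
  `P[ΔY_0 = s_0, …, ΔY_{n-1} = s_{n-1}] = 2^{-n}` for every sign pattern
  (`measure_steps_eq`); `E[Δτ_k] = 1` (`integral_gap`), `E[Δτ_k²] ≤ 32/(1-θ₀)²`
  (`integral_gap_sq_le`) and the geometric tail `P[4m < Δτ_k] ≤ θ₀^m`,
  `θ₀ = P[|N(0,1)| < 1] < 1` (`measure_lt_gap_le_pow`; `θ₀ < 1` is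
  `gaussianReal_Ioo_neg_one_one_lt_one`) — Lawler's "`E(τ₁) = 1` and
  `E(e^{tτ₁}) < ∞` for some `t > 0`".

## References

* G. F. Lawler, *Cut times for simple random walk*, Electron. J. Probab. **1** (1996), no. 13,
  §3. [Lawler1996CutTimes]
* R. Durrett, *Probability: Theory and Examples*, 5th ed. (2019), Thm. 7.5.3, 7.5.5, 8.1.1 and
  the proof of Thm. 8.2.1. [Durrett2019]
* J.-F. Le Gall, *Brownian Motion, Martingales, and Stochastic Calculus* (2016), Thm. 2.20.
  [Legall2016]
-/

noncomputable section

open MeasureTheory ProbabilityTheory Filter Set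
open scoped NNReal ENNReal Topology BigOperators

namespace Literature.Probability.RandomPlanarGeometry

namespace SkorokhodSRW

/-! ### The renewal maps and the embedded walk -/

/-- **One renewal step**: the post-exit path of `(-1, 1)`, `u ↦ p(τ₁ + u) - p(τ₁)`.
Lawler (1996), §3 (`τ_n = inf{t > τ_{n-1} : |X(t) - X(τ_{n-1})| = 1}`). [folklore] -/
def next : C(ℝ≥0, ℝ) → C(ℝ≥0, ℝ) := postExitPath (-1) 1

/-- **The path after the `k`-th embedding time**, re-centred: `next^[k]`. [folklore] -/
def iter (k : ℕ) : C(ℝ≥0, ℝ) → C(ℝ≥0, ℝ) := next^[k]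

/-- **The `k`-th gap `Δτ_k = τ_{k+1} - τ_k`** in `ℝ≥0` (junk `0` if the renewed path never exits
`(-1, 1)`, a null event). [folklore] -/
def gapNN (k : ℕ) (p : C(ℝ≥0, ℝ)) : ℝ≥0 := (pathExitTime (-1) 1 (iter k p)).untopD 0

/-- The `k`-th gap `Δτ_k` as a real number. [folklore] -/
def gap (k : ℕ) (p : C(ℝ≥0, ℝ)) : ℝ := pathExitTimeReal (-1) 1 (iter k p)

/-- **The `k`-th step `ΔY_k = Y(k+1) - Y(k)`** of the embedded walk: the exit value of `(-1, 1)`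
of the `k`-th renewed path (a.s. `±1`). [folklore] -/
def step (k : ℕ) (p : C(ℝ≥0, ℝ)) : ℝ := pathExitValue (-1) 1 (iter k p)

/-- **The `n`-th embedding time `τ_n = Δτ_0 + ⋯ + Δτ_{n-1}`.** Lawler (1996), §3. [folklore] -/
def embTime (n : ℕ) (p : C(ℝ≥0, ℝ)) : ℝ≥0 := ∑ k ∈ Finset.range n, gapNN k p

/-- **The embedded walk `Y(n) = ΔY_0 + ⋯ + ΔY_{n-1}`** (a.s. `= p(τ_n)`,
`ae_apply_embTime_eq_walk`). Lawler (1996), §3 (`Y(n) = X(τ_n)`). [folklore] -/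
def walk (n : ℕ) (p : C(ℝ≥0, ℝ)) : ℝ := ∑ k ∈ Finset.range n, step k p

/-- `iter 0` is the identity (definitional). [folklore] -/
@[simp] theorem iter_zero (p : C(ℝ≥0, ℝ)) : iter 0 p = p := rfl

/-- `iter (k+1) p = iter k (next p)` (definitional). [folklore] -/
theorem iter_succ_apply (k : ℕ) (p : C(ℝ≥0, ℝ)) : iter (k + 1) p = iter k (next p) :=
  Function.iterate_succ_apply next k p

/-- `iter (k+1) p = next (iter k p)`. [folklore] -/
theorem iter_succ_apply' (k : ℕ) (p : C(ℝ≥0, ℝ)) : iter (k + 1) p = next (iter k p) :=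
  Function.iterate_succ_apply' next k p

/-- `iter 1 = next` (definitional). [folklore] -/
theorem iter_one (p : C(ℝ≥0, ℝ)) : iter 1 p = next p := rfl

/-- The real gap is the coercion of the `ℝ≥0` gap (definitional). [folklore] -/
theorem gap_eq_coe_gapNN (k : ℕ) (p : C(ℝ≥0, ℝ)) : gap k p = (gapNN k p : ℝ) := rfl

/-- Gaps are nonnegative. [folklore] -/
theorem gap_nonneg (k : ℕ) (p : C(ℝ≥0, ℝ)) : 0 ≤ gap k p := NNReal.coe_nonneg _

/-- **Renewal recursion for the gaps**: `Δτ_{k+1}(p) = Δτ_k(next p)` (definitional). [folklore] -/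
theorem gapNN_succ (k : ℕ) (p : C(ℝ≥0, ℝ)) : gapNN (k + 1) p = gapNN k (next p) := by
  simp only [gapNN, iter_succ_apply]

/-- Renewal recursion for the real gaps (definitional). [folklore] -/
theorem gap_succ (k : ℕ) (p : C(ℝ≥0, ℝ)) : gap (k + 1) p = gap k (next p) := by
  simp only [gap, iter_succ_apply]

/-- **Renewal recursion for the steps**: `ΔY_{k+1}(p) = ΔY_k(next p)` (definitional). [folklore] -/
theorem step_succ (k : ℕ) (p : C(ℝ≥0, ℝ)) : step (k + 1) p = step k (next p) := by
  simp only [step, iter_succ_apply]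

/-- Gaps of a renewed path are later gaps. [folklore] -/
theorem gapNN_iter (k j : ℕ) (p : C(ℝ≥0, ℝ)) : gapNN k (iter j p) = gapNN (k + j) p := by
  simp only [gapNN, iter, ← Function.iterate_add_apply]

/-- Steps of a renewed path are later steps. [folklore] -/
theorem step_iter (k j : ℕ) (p : C(ℝ≥0, ℝ)) : step k (iter j p) = step (k + j) p := by
  simp only [step, iter, ← Function.iterate_add_apply]

/-- `τ_0 = 0`. [folklore] -/
@[simp] theorem embTime_zero (p : C(ℝ≥0, ℝ)) : embTime 0 p = 0 := by simp [embTime]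

/-- `Y(0) = 0`. [folklore] -/
@[simp] theorem walk_zero (p : C(ℝ≥0, ℝ)) : walk 0 p = 0 := by simp [walk]

/-- `τ_{n+1} = τ_n + Δτ_n`. [folklore] -/
theorem embTime_succ (n : ℕ) (p : C(ℝ≥0, ℝ)) : embTime (n + 1) p = embTime n p + gapNN n p := by
  simp [embTime, Finset.sum_range_succ]

/-- `Y(n+1) = Y(n) + ΔY_n`. [folklore] -/
theorem walk_succ (n : ℕ) (p : C(ℝ≥0, ℝ)) : walk (n + 1) p = walk n p + step n p := by
  simp [walk, Finset.sum_range_succ]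

/-- **Renewal recursion for the embedding times**: `τ_{n+1}(p) = Δτ_0(p) + τ_n(next p)`.
[folklore] -/
theorem embTime_succ' (n : ℕ) (p : C(ℝ≥0, ℝ)) :
    embTime (n + 1) p = gapNN 0 p + embTime n (next p) := by
  simp only [embTime, Finset.sum_range_succ' (fun k ↦ gapNN k p), gapNN_succ]
  rw [add_comm]

/-- **Renewal recursion for the walk**: `Y(n+1)(p) = ΔY_0(p) + Y(n)(next p)`. [folklore] -/
theorem walk_succ' (n : ℕ) (p : C(ℝ≥0, ℝ)) : walk (n + 1) p = step 0 p + walk n (next p) := by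
  simp only [walk, Finset.sum_range_succ' (fun k ↦ step k p), step_succ]
  rw [add_comm]

/-- `τ_n` as a real number is the sum of the real gaps. [folklore] -/
theorem coe_embTime (n : ℕ) (p : C(ℝ≥0, ℝ)) :
    (embTime n p : ℝ) = ∑ k ∈ Finset.range n, gap k p := by
  simp [embTime, gap_eq_coe_gapNN]

/-- The embedding times increase with `n`. [folklore] -/
theorem embTime_mono (p : C(ℝ≥0, ℝ)) : Monotone fun n ↦ embTime n p := by
  refine monotone_nat_of_le_succ fun n ↦ ?_
  rw [embTime_succ]
  exact le_self_add

/-- At a finite `k`-th exit time `T`, the `ℝ≥0` gap is `T`. [folklore] -/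
theorem gapNN_of_eq_coe {k : ℕ} {p : C(ℝ≥0, ℝ)} {T : ℝ≥0}
    (hT : pathExitTime (-1) 1 (iter k p) = T) : gapNN k p = T := by
  rw [gapNN, hT]
  rfl

/-- If the `k`-th renewed path exits `(-1, 1)`, its exit time is the `k`-th gap. [folklore] -/
theorem pathExitTime_iter_eq_coe {k : ℕ} {p : C(ℝ≥0, ℝ)}
    (h : pathExitTime (-1) 1 (iter k p) ≠ ⊤) : pathExitTime (-1) 1 (iter k p) = (gapNN k p : ℝ≥0) := by
  obtain ⟨T, hT⟩ := WithTop.ne_top_iff_exists.1 h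
  rw [gapNN_of_eq_coe hT.symm, hT]

/-! ### The shifted-path calculus behind `p(τ_n) = Y(n)` -/

/-- **The renewed paths are shifts of the original path at the embedding times**: if `p 0 = 0`
and the first `k` renewed paths all exit `(-1, 1)`, then `iter k p = (u ↦ p(τ_k + u) - p(τ_k))`.
[folklore] -/
theorem iter_eq_shiftPath_embTime {p : C(ℝ≥0, ℝ)} (h0 : p 0 = 0) :
    ∀ k, (∀ j < k, pathExitTime (-1) 1 (iter j p) ≠ ⊤) → iter k p = shiftPath (embTime k p) p := by
  intro k
  induction k with
  | zero => intro _; simp [SkorokhodEmbedding.shiftPath_zero_of_apply_zero h0]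
  | succ k ih =>
    intro hk
    have hk' : ∀ j < k, pathExitTime (-1) 1 (iter j p) ≠ ⊤ := fun j hj ↦ hk j (hj.trans k.lt_succ_self)
    have hT := pathExitTime_iter_eq_coe (hk k k.lt_succ_self)
    rw [iter_succ_apply', embTime_succ]
    ext u
    change postExitPath (-1) 1 (iter k p) u = _
    rw [postExitPath_apply_of_eq_coe hT, ih hk', shiftPath_apply, shiftPath_apply, shiftPath_apply]
    rw [add_assoc]
    ring

/-- **The steps are increments of the path between consecutive embedding times**:
`ΔY_k = p(τ_{k+1}) - p(τ_k)` (under the hypotheses of `iter_eq_shiftPath_embTime`). [folklore] -/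
theorem step_eq_apply_sub_apply {p : C(ℝ≥0, ℝ)} (h0 : p 0 = 0) {k : ℕ}
    (hk : ∀ j ≤ k, pathExitTime (-1) 1 (iter j p) ≠ ⊤) :
    step k p = p (embTime (k + 1) p) - p (embTime k p) := by
  have hT := pathExitTime_iter_eq_coe (hk k le_rfl)
  have hit := iter_eq_shiftPath_embTime h0 k fun j hj ↦ hk j hj.le
  unfold step
  rw [pathExitValue_of_eq_coe hT, hit, shiftPath_apply, embTime_succ]

/-- **The embedding identity** `p(τ_n) = Y(n)`, pathwise form: if `p 0 = 0` and the first `n`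
renewed paths exit `(-1, 1)`, then `p(τ_m) = Y(m)` for all `m ≤ n`. Lawler (1996), §3
(`Y(n) = X(τ_n)`). [folklore] -/
theorem apply_embTime_eq_walk {p : C(ℝ≥0, ℝ)} (h0 : p 0 = 0) {n : ℕ}
    (hn : ∀ j < n, pathExitTime (-1) 1 (iter j p) ≠ ⊤) : p (embTime n p) = walk n p := by
  induction n with
  | zero => simp [h0]
  | succ n ih =>
    have hn' : ∀ j < n, pathExitTime (-1) 1 (iter j p) ≠ ⊤ := fun j hj ↦ hn j (hj.trans n.lt_succ_self)
    rw [walk_succ, ← ih hn', step_eq_apply_sub_apply h0 fun j hj ↦ hn j (Nat.lt_succ_of_le hj)]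
    ring

/-! ### The exit value as a functional of the exit data -/

/-- **The exit data** of `(-1, 1)`: the pair (exit time, pre-exit path). [folklore] -/
def exitData (p : C(ℝ≥0, ℝ)) : WithTop ℝ≥0 × C(ℝ≥0, ℝ) := (pathExitTime (-1) 1 p, preExitPath (-1) 1 p)

/-- Reading `(Δτ₀, ΔY₀)` off the exit data. [folklore] -/
def gapStepOf (d : WithTop ℝ≥0 × C(ℝ≥0, ℝ)) : ℝ≥0 × ℝ := (d.1.untopD 0, d.2 d.1.untopA)

/-- `(Δτ₀, ΔY₀)` is a function of the exit data. [folklore] -/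
theorem gapStepOf_exitData (p : C(ℝ≥0, ℝ)) : gapStepOf (exitData p) = (gapNN 0 p, step 0 p) := by
  simp only [gapStepOf, exitData, gapNN, step, iter_zero,
    SkorokhodEmbedding.pathExitValue_eq_preExitPath_apply]

/-- Peeling off the first step of a pattern event (renewal recursion). [folklore] -/
theorem setOf_steps_succ (n : ℕ) (s : ℕ → ℝ) :
    {p : C(ℝ≥0, ℝ) | ∀ i < n + 1, step i p = s i} =
      step 0 ⁻¹' {s 0} ∩ next ⁻¹' {q | ∀ i < n, step i q = s (i + 1)} := by
  ext p
  simp only [mem_setOf_eq, mem_inter_iff, mem_preimage, mem_singleton_iff]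
  constructor
  · intro h
    exact ⟨h 0 (Nat.succ_pos n), fun i hi ↦ by rw [← step_succ]; exact h (i + 1) (by omega)⟩
  · rintro ⟨h0, h⟩ i hi
    cases i with
    | zero => exact h0
    | succ i => rw [step_succ]; exact h i (by omega)

section Law

variable [MeasurableSpace C(ℝ≥0, ℝ)] [BorelSpace C(ℝ≥0, ℝ)]

/-! ### Measurability -/

/-- The renewal map is measurable. [folklore] -/
theorem measurable_next : Measurable next := measurable_postExitPath _ _

/-- The renewal iterates are measurable. [folklore] -/
theorem measurable_iter (k : ℕ) : Measurable (iter k) := measurable_next.iterate k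

/-- The gaps are measurable (`ℝ≥0` form). [folklore] -/
theorem measurable_gapNN (k : ℕ) : Measurable (gapNN k) :=
  ((measurable_pathExitTime _ _).comp (measurable_iter k)).untopD _

/-- The gaps are measurable (real form). [folklore] -/
theorem measurable_gap (k : ℕ) : Measurable (gap k) :=
  (measurable_pathExitTimeReal _ _).comp (measurable_iter k)

/-- The steps are measurable. [folklore] -/
theorem measurable_step (k : ℕ) : Measurable (step k) :=
  (measurable_pathExitValue _ _).comp (measurable_iter k)

/-- The embedding times are measurable. [folklore] -/
theorem measurable_embTime (n : ℕ) : Measurable (embTime n) := by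
  unfold embTime
  exact Finset.measurable_sum _ fun k _ ↦ measurable_gapNN k

/-- The embedded walk is measurable. [folklore] -/
theorem measurable_walk (n : ℕ) : Measurable (walk n) := by
  unfold walk
  exact Finset.measurable_sum _ fun k _ ↦ measurable_step k

/-- The exit data are measurable. [folklore] -/
theorem measurable_exitData : Measurable exitData :=
  (measurable_pathExitTime _ _).prodMk (measurable_preExitPath _ _)

/-- Reading `(Δτ₀, ΔY₀)` off the exit data is measurable. [folklore] -/
theorem measurable_gapStepOf : Measurable gapStepOf := by
  refine (measurable_fst.untopD _).prodMk ?_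
  exact measurable_uncurry_coordProcess.comp (measurable_fst.untopA.prodMk measurable_snd)

/-- `(Δτ₀, ΔY₀)` is measurable. [folklore] -/
theorem measurable_gapStep_zero : Measurable fun p : C(ℝ≥0, ℝ) ↦ (gapNN 0 p, step 0 p) :=
  (measurable_gapNN 0).prodMk (measurable_step 0)

/-! ### Renewal structure: measure preservation and independence -/

/-- **One renewal preserves the Wiener law** (strong Markov at the exit time of `(-1, 1)`).
Durrett (2019), proof of Thm. 8.2.1. [cite: Legall2016, Thm. 2.20] -/
theorem measurePreserving_next : MeasurePreserving next wienerLawC wienerLawC :=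
  ⟨measurable_next, map_postExitPath_wienerLawC (by norm_num) (by norm_num)⟩

/-- **Every renewal iterate preserves the Wiener law.** [folklore] -/
theorem measurePreserving_iter (k : ℕ) : MeasurePreserving (iter k) wienerLawC wienerLawC :=
  measurePreserving_next.iterate k

/-- **The renewed path is independent of the exit data** (strong Markov at the exit time of
`(-1, 1)`, independence half). [cite: Legall2016, Thm. 2.20] -/
theorem indepFun_next_exitData : IndepFun next exitData wienerLawC :=
  indepFun_postExitPath_wienerLawC (by norm_num) (by norm_num)

/-- **`(Δτ₀, ΔY₀)` is independent of every measurable functional of the renewed path.**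
Durrett (2019), proof of Thm. 8.2.1 ("`{B(T_{k-1} + t) - B(T_{k-1})}` is a Brownian motion
independent of `𝓕(T_{k-1})`"). [folklore] -/
theorem indepFun_gapStep_zero_comp_next {β : Type*} [MeasurableSpace β] {F : C(ℝ≥0, ℝ) → β}
    (hF : Measurable F) :
    IndepFun (fun p ↦ (gapNN 0 p, step 0 p)) (fun p ↦ F (next p)) wienerLawC := by
  have h := (indepFun_next_exitData.symm).comp measurable_gapStepOf hF
  have heq : (gapStepOf ∘ exitData) = fun p ↦ (gapNN 0 p, step 0 p) := by
    funext p
    exact gapStepOf_exitData p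
  rwa [heq] at h

/-- `ΔY₀` alone is independent of every measurable functional of the renewed path. [folklore] -/
theorem indepFun_step_zero_comp_next {β : Type*} [MeasurableSpace β] {F : C(ℝ≥0, ℝ) → β}
    (hF : Measurable F) : IndepFun (step 0) (fun p ↦ F (next p)) wienerLawC := by
  have h := (indepFun_gapStep_zero_comp_next hF).comp measurable_snd measurable_id
  exact h

/-- `Δτ₀` alone is independent of every measurable functional of the renewed path. [folklore] -/
theorem indepFun_gapNN_zero_comp_next {β : Type*} [MeasurableSpace β] {F : C(ℝ≥0, ℝ) → β}
    (hF : Measurable F) : IndepFun (gapNN 0) (fun p ↦ F (next p)) wienerLawC := by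
  have h := (indepFun_gapStep_zero_comp_next hF).comp measurable_fst measurable_id
  exact h

/-- The real gap `Δτ₀` is independent of every measurable functional of the renewed path.
[folklore] -/
theorem indepFun_gap_zero_comp_next {β : Type*} [MeasurableSpace β] {F : C(ℝ≥0, ℝ) → β}
    (hF : Measurable F) : IndepFun (gap 0) (fun p ↦ F (next p)) wienerLawC := by
  have h := (indepFun_gapNN_zero_comp_next hF).comp measurable_coe_nnreal_real measurable_id
  exact h

/-- **Identical distribution of the renewal data**: `(Δτ_k, ΔY_k)` has the law of `(Δτ₀, ΔY₀)`.
[folklore] -/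
theorem identDistrib_gapStep (k : ℕ) :
    IdentDistrib (fun p ↦ (gapNN k p, step k p)) (fun p ↦ (gapNN 0 p, step 0 p))
      wienerLawC wienerLawC := by
  have h : (fun p ↦ (gapNN k p, step k p)) = (fun p ↦ (gapNN 0 p, step 0 p)) ∘ iter k := by
    funext p
    simp only [Function.comp_apply, gapNN_iter, step_iter, zero_add]
  rw [h]
  exact ⟨(measurable_gapStep_zero.comp (measurable_iter k)).aemeasurable,
    measurable_gapStep_zero.aemeasurable, by
      rw [← Measure.map_map measurable_gapStep_zero (measurable_iter k),
        (measurePreserving_iter k).map_eq]⟩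

/-- `ΔY_k` has the law of `ΔY₀`. [folklore] -/
theorem identDistrib_step (k : ℕ) : IdentDistrib (step k) (step 0) wienerLawC wienerLawC :=
  (identDistrib_gapStep k).comp measurable_snd

/-- `Δτ_k` has the law of `Δτ₀` (`ℝ≥0` form). [folklore] -/
theorem identDistrib_gapNN (k : ℕ) : IdentDistrib (gapNN k) (gapNN 0) wienerLawC wienerLawC :=
  (identDistrib_gapStep k).comp measurable_fst

/-- `Δτ_k` has the law of `Δτ₀` (real form). [folklore] -/
theorem identDistrib_gap (k : ℕ) : IdentDistrib (gap k) (gap 0) wienerLawC wienerLawC :=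
  (identDistrib_gapNN k).comp measurable_coe_nnreal_real

/-- `ΔY₀` is independent of the renewed path itself. [folklore] -/
theorem indepFun_step_zero_next : IndepFun (step 0) next wienerLawC :=
  indepFun_step_zero_comp_next measurable_id

/-! ### Almost sure structure of the embedding -/

/-- Wiener-a.e. path exits `(-1, 1)` at `±1`. [folklore] -/
theorem ae_exit_zero : ∀ᵐ p ∂wienerLawC,
    pathExitTime (-1) 1 p ≠ ⊤ ∧ (pathExitValue (-1) 1 p = -1 ∨ pathExitValue (-1) 1 p = 1) :=
  ae_pathExitValue_eq_or_eq_wienerLawC (by norm_num) (by norm_num)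

/-- **Almost surely every embedding time is finite and every step is `±1`.** Lawler (1996), §3
("Skorokhod embedding of a simple random walk"). [folklore] -/
theorem ae_exit_ne_top_and_step : ∀ᵐ p ∂wienerLawC,
    ∀ k, pathExitTime (-1) 1 (iter k p) ≠ ⊤ ∧ (step k p = -1 ∨ step k p = 1) := by
  rw [ae_all_iff]
  intro k
  exact ((measurePreserving_iter k).quasiMeasurePreserving.ae ae_exit_zero).mono fun p hp ↦ hp

/-- Almost surely every step has absolute value `1`. [folklore] -/
theorem ae_abs_step_eq_one : ∀ᵐ p ∂wienerLawC, ∀ k, |step k p| = 1 := by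
  filter_upwards [ae_exit_ne_top_and_step] with p hp k
  rcases (hp k).2 with h | h <;> simp [h]

/-- **Almost surely the renewed paths are the shifts of the path at the embedding times**:
`iter k p = (u ↦ p(τ_k + u) - p(τ_k))` for all `k`. [folklore] -/
theorem ae_iter_eq_shiftPath : ∀ᵐ p ∂wienerLawC, ∀ k, iter k p = shiftPath (embTime k p) p := by
  filter_upwards [ae_exit_ne_top_and_step, ae_apply_zero_eq_zero_wienerLawC] with p hp h0 k
  exact iter_eq_shiftPath_embTime h0 k fun j _ ↦ (hp j).1

/-- **Almost surely the steps are the increments of the path between consecutive embedding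
times**: `ΔY_k = p(τ_{k+1}) - p(τ_k)` for all `k`. [folklore] -/
theorem ae_step_eq_apply_sub : ∀ᵐ p ∂wienerLawC,
    ∀ k, step k p = p (embTime (k + 1) p) - p (embTime k p) := by
  filter_upwards [ae_exit_ne_top_and_step, ae_apply_zero_eq_zero_wienerLawC] with p hp h0 k
  exact step_eq_apply_sub_apply h0 fun j _ ↦ (hp j).1

/-- **The embedding identity `X(τ_n) = Y(n)` for all `n`, almost surely.** Lawler (1996), §3
(`Y(n) = X(τ_n)`); Durrett (2019), Thm. 8.2.1. [cite: Lawler1996CutTimes, §3] -/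
theorem ae_apply_embTime_eq_walk : ∀ᵐ p ∂wienerLawC, ∀ n, p (embTime n p) = walk n p := by
  filter_upwards [ae_exit_ne_top_and_step, ae_apply_zero_eq_zero_wienerLawC] with p hp h0 n
  exact apply_embTime_eq_walk h0 fun j _ ↦ (hp j).1

/-! ### The law of the steps: a simple random walk -/

/-- `P[ΔY₀ = 1] = 1/2` (gambler's ruin from `0` in `(-1, 1)`), real form.
[cite: Durrett2019, Thm. 7.5.3] -/
theorem measureReal_step_zero_eq_one : wienerLawC.real {p | step 0 p = 1} = 1 / 2 := by
  have hset : {p : C(ℝ≥0, ℝ) | step 0 p = 1} =ᵐ[wienerLawC]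
      {p | pathExitTime (-1) 1 p ≠ ⊤ ∧ pathExitValue (-1) 1 p = 1} := by
    filter_upwards [ae_exit_zero] with p hp
    simp only [eq_iff_iff]
    exact ⟨fun h1 ↦ ⟨hp.1, h1⟩, fun h1 ↦ h1.2⟩
  rw [measureReal_congr hset, wienerLawC_real_exitRight (by norm_num) (by norm_num)]
  norm_num

/-- `P[ΔY₀ = -1] = 1/2`, real form. [cite: Durrett2019, Thm. 7.5.3] -/
theorem measureReal_step_zero_eq_neg_one : wienerLawC.real {p | step 0 p = -1} = 1 / 2 := by
  have hset : {p : C(ℝ≥0, ℝ) | step 0 p = -1} =ᵐ[wienerLawC]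
      {p | pathExitTime (-1) 1 p ≠ ⊤ ∧ pathExitValue (-1) 1 p = -1} := by
    filter_upwards [ae_exit_zero] with p hp
    simp only [eq_iff_iff]
    exact ⟨fun h1 ↦ ⟨hp.1, h1⟩, fun h1 ↦ h1.2⟩
  rw [measureReal_congr hset, wienerLawC_real_exitLeft (by norm_num) (by norm_num)]
  norm_num

/-- **`P[ΔY_k = c] = 1/2` for `c = ±1`**, real form. [cite: Durrett2019, Thm. 7.5.3] -/
theorem measureReal_step_eq (k : ℕ) {c : ℝ} (hc : c = 1 ∨ c = -1) :
    wienerLawC.real {p | step k p = c} = 1 / 2 := by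
  have h := (identDistrib_step k).measure_mem_eq (measurableSet_singleton c)
  change wienerLawC.real (step k ⁻¹' {c}) = 1 / 2
  rw [measureReal_def, h, ← measureReal_def]
  rcases hc with rfl | rfl
  · exact measureReal_step_zero_eq_one
  · exact measureReal_step_zero_eq_neg_one

/-- **`P[ΔY_k = c] = 1/2` for `c = ±1`**, `ℝ≥0∞` form. [cite: Durrett2019, Thm. 7.5.3] -/
theorem measure_step_eq (k : ℕ) {c : ℝ} (hc : c = 1 ∨ c = -1) :
    wienerLawC {p | step k p = c} = 2⁻¹ := by
  have h := measureReal_step_eq k hc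
  rw [measureReal_def] at h
  have h' := congrArg ENNReal.ofReal h
  rw [ENNReal.ofReal_toReal (measure_ne_top _ _)] at h'
  rw [h', one_div, ENNReal.ofReal_inv_of_pos two_pos, ENNReal.ofReal_ofNat]

/-- The event "the first `n` steps follow the pattern `s`" is measurable. [folklore] -/
theorem measurableSet_steps (n : ℕ) (s : ℕ → ℝ) :
    MeasurableSet {p : C(ℝ≥0, ℝ) | ∀ i < n, step i p = s i} := by
  have : {p : C(ℝ≥0, ℝ) | ∀ i < n, step i p = s i} =
      ⋂ i ∈ Finset.range n, step i ⁻¹' {s i} := by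
    ext p
    simp
  rw [this]
  exact Finset.measurableSet_biInter _ fun i _ ↦ measurable_step i (measurableSet_singleton _)

/-- **The embedded steps are a simple random walk**: for every sign pattern
`s_0, …, s_{n-1} ∈ {±1}`, `P[ΔY_0 = s_0, …, ΔY_{n-1} = s_{n-1}] = 2^{-n}` — the steps are
i.i.d. uniform on `{±1}` (strong Markov at the embedding times + gambler's ruin). Lawler (1996),
§3 ("Skorokhod embedding of a simple random walk `Y(n)` in a Brownian motion"); Durrett (2019),
Thm. 8.2.1. [cite: Lawler1996CutTimes, §3] -/
theorem measure_steps_eq (n : ℕ) (s : ℕ → ℝ) (hs : ∀ i < n, s i = 1 ∨ s i = -1) :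
    wienerLawC {p | ∀ i < n, step i p = s i} = 2⁻¹ ^ n := by
  induction n generalizing s with
  | zero => simp
  | succ n ih =>
    have hE := measurableSet_steps n (fun i ↦ s (i + 1))
    rw [setOf_steps_succ, indepFun_step_zero_next.measure_inter_preimage_eq_mul _ _
      (measurableSet_singleton _) hE, measurePreserving_next.measure_preimage hE.nullMeasurableSet,
      ih (fun i ↦ s (i + 1)) (fun i hi ↦ hs (i + 1) (by omega)), pow_succ']
    congr 1
    exact measure_step_eq 0 (hs 0 (Nat.succ_pos n))

/-- The simple-random-walk law, real form: `P[ΔY_0 = s_0, …, ΔY_{n-1} = s_{n-1}] = (1/2)^n`.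
[cite: Lawler1996CutTimes, §3] -/
theorem measureReal_steps_eq (n : ℕ) (s : ℕ → ℝ) (hs : ∀ i < n, s i = 1 ∨ s i = -1) :
    wienerLawC.real {p | ∀ i < n, step i p = s i} = (1 / 2) ^ n := by
  rw [measureReal_def, measure_steps_eq n s hs, ENNReal.toReal_pow, ENNReal.toReal_inv]
  norm_num

/-! ### Moments and tail of the gaps: `E(τ₁) = 1`, `E(e^{tτ₁}) < ∞` -/

/-- The gaps are integrable. [folklore] -/
theorem integrable_gap (k : ℕ) : Integrable (gap k) wienerLawC :=
  (identDistrib_gap k).symm.integrable_snd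
    (integrable_pathExitTimeReal_wienerLawC (by norm_num) (by norm_num))

/-- **`E[Δτ_k] = 1`** (`E T_{-1,1} = -ab = 1`). Lawler (1996), §3 ("`E(τ₁) = 1`"); Durrett
(2019), Thm. 7.5.5. [cite: Lawler1996CutTimes, §3] -/
theorem integral_gap (k : ℕ) : ∫ p, gap k p ∂wienerLawC = 1 := by
  rw [(identDistrib_gap k).integral_eq]
  change ∫ p, pathExitTimeReal (-1) 1 p ∂wienerLawC = 1
  rw [integral_pathExitTimeReal_wienerLawC (by norm_num) (by norm_num)]
  norm_num

/-- The squared gaps are integrable. [folklore] -/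
theorem integrable_gap_sq (k : ℕ) : Integrable (fun p ↦ gap k p ^ 2) wienerLawC :=
  ((identDistrib_gap k).comp (measurable_id.pow_const 2)).symm.integrable_snd
    (integrable_pathExitTimeReal_sq_wienerLawC (by norm_num) (by norm_num))

/-- **`E[Δτ_k²] ≤ 32/(1-θ₀)²`**, `θ₀ = P[|N(0,1)| < 1]`. [folklore] -/
theorem integral_gap_sq_le (k : ℕ) :
    ∫ p, gap k p ^ 2 ∂wienerLawC ≤ 32 / (1 - (gaussianReal 0 1).real (Ioo (-1) 1)) ^ 2 := by
  have h := ((identDistrib_gap k).comp (measurable_id.pow_const 2)).integral_eq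
  simp only [Function.comp_def, id] at h
  rw [h]
  change ∫ p, pathExitTimeReal (-1) 1 p ^ 2 ∂wienerLawC ≤ _
  refine (integral_pathExitTimeReal_sq_wienerLawC_le (by norm_num) (by norm_num)).trans_eq ?_
  norm_num
  ring

/-- The strict super-level events of the path exit time are measurable. [folklore] -/
theorem measurableSet_coe_lt_pathExitTime (a b : ℝ) (c : ℝ≥0) :
    MeasurableSet {p : C(ℝ≥0, ℝ) | (c : WithTop ℝ≥0) < pathExitTime a b p} :=
  measurable_pathExitTime a b measurableSet_Ioi

/-- **Geometric tail of the first gap**: `P[4m < Δτ₀] ≤ θ₀^m`, `θ₀ = P[|N(0,1)| < 1] < 1` (weak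
Markov at the times `4j`, `BrownianExitIntervalTail`). This is Lawler's "`E(e^{tτ₁}) < ∞` for
some `t > 0`" (1996, §3). [cite: Lawler1996CutTimes, §3] -/
theorem measure_lt_gap_zero_le_pow (m : ℕ) :
    wienerLawC {p | (4 * m : ℝ) < gap 0 p} ≤ gaussianReal 0 1 (Ioo (-1) 1) ^ m := by
  have hsub : {p : C(ℝ≥0, ℝ) | (4 * m : ℝ) < gap 0 p} ⊆
      {p | (((m : ℝ≥0) * 4 : ℝ≥0) : WithTop ℝ≥0) < pathExitTime (-1) 1 p} := by
    intro p hp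
    simp only [mem_setOf_eq, gap, iter_zero] at hp ⊢
    rcases eq_or_ne (pathExitTime (-1) 1 p) ⊤ with h | h
    · exfalso
      simp only [pathExitTimeReal, h, WithTop.untopD_top, NNReal.coe_zero] at hp
      have : (0 : ℝ) ≤ 4 * m := by positivity
      linarith
    · obtain ⟨T, hT⟩ := WithTop.ne_top_iff_exists.1 h
      rw [pathExitTimeReal_of_eq_coe hT.symm] at hp
      rw [← hT, WithTop.coe_lt_coe, ← NNReal.coe_lt_coe]
      push_cast
      linarith
  refine (measure_mono hsub).trans ?_
  rw [wienerLawC_apply (measurableSet_coe_lt_pathExitTime _ _ _)]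
  exact measure_mul_lt_exitTime_brownian_le_pow (a := -1) (b := 1) (by norm_num) (h := 4)
    (by norm_num) m

/-- **Geometric tail of every gap**: `P[4m < Δτ_k] ≤ θ₀^m`. [cite: Lawler1996CutTimes, §3] -/
theorem measure_lt_gap_le_pow (k m : ℕ) :
    wienerLawC {p | (4 * m : ℝ) < gap k p} ≤ gaussianReal 0 1 (Ioo (-1) 1) ^ m := by
  have h := (identDistrib_gap k).measure_mem_eq measurableSet_Ioi (s := Ioi (4 * m : ℝ))
  change wienerLawC (gap k ⁻¹' Ioi (4 * m : ℝ)) ≤ _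
  rw [h]
  exact measure_lt_gap_zero_le_pow m

end Law

end SkorokhodSRW

end Literature.Probability.RandomPlanarGeometry
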